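import Mathlib

/-!
# The group of a dot–zero swap sphere is infinite cyclic (algebraic core)

Solo residency `solo-SmoothPoincare4-informed`, session 8; algebraic core of Theorem 8.5(a) of the
residency file `paper/one-stabilisation.md` (a prose result under adjudication, not a theorem of
this tree).

Geometric provenance (prose, not formalised here).  A *swap datum* is a link
`𝕃 = 𝔻₁ ⊔ 𝔻₂ ⊂ S³` (two `s`-component unlinks, framings `0`) with `{𝔻₁•, 𝔻₂⁰} ≅ B⁴ ≅ {𝔻₂•, 𝔻₁⁰}`,
together with an unknot `C` split from `𝔻₁` and from `𝔻₂`; the *swap sphere* `S(𝕃, C) ⊂ S⁴` is the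
union of the two slice discs bounded by `C` on the two sides (Hayden's exotic ribbon discs are the
case `s = 1`).  Its exterior has the Kirby diagram `{𝔻₁•, C•, 𝔻₂⁰} ∪ {0-framed meridians of the
dotted circles of 𝔻₁} ∪ (3-handles)`, so its fundamental group is presented on generators
`x_γ (γ ∈ 𝔻₁)` and `c`, with relators the generators `x_γ` themselves (a `0`-framed meridian of a
dotted circle kills it) and the attaching words `w_β (β ∈ 𝔻₂)`, each of exponent sum
`lk(β, C) = 0` in `c`.

What is proved here (pure group theory, kernel-checked): for ANY index types, ANY family of words
`w : B → FreeGroup (Option ι)` with exponent sum `0` in the distinguished generator `none`, the group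
`⟨ Option ι ∣ of (some i) (i : ι), w b (b : B) ⟩` is isomorphic to `ℤ`, the class of `none` going to
`1`.  (`none` plays the meridian `c`, `some i` the dotted circles of `𝔻₁`.)
-/

namespace Summit.SmoothPoincare4.SmoothPoincare4.Theorems
namespace SwapSphere

open Multiplicative

variable {ι : Type*} {B : Type*}

/-- Images of the generators in `ℤ`: the meridian `none ↦ 1`, every dotted circle `some i ↦ 0`
(written multiplicatively). -/
def genZ : Option ι → Multiplicative ℤ
  | none => ofAdd 1
  | some _ => 1

/-- Exponent sum of the distinguished generator `none` (the meridian `c`). -/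
def expSumC : FreeGroup (Option ι) →* Multiplicative ℤ := FreeGroup.lift genZ

/-- The meridian has exponent sum `1`. -/
@[simp] theorem expSumC_of_none : expSumC (FreeGroup.of (none : Option ι)) = ofAdd 1 := by
  simp [expSumC, genZ]

/-- A dotted-circle generator has meridian exponent sum `0`. -/
@[simp] theorem expSumC_of_some (i : ι) : expSumC (FreeGroup.of (some i)) = 1 := by
  simp [expSumC, genZ]

/-- Relators of the swap-sphere exterior: every generator `some i`, and the words `w b`. -/
def swapRels (w : B → FreeGroup (Option ι)) : Set (FreeGroup (Option ι)) :=
  Set.range (fun i : ι => FreeGroup.of (some i)) ∪ Set.range w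

/-- The presented group `⟨ Option ι ∣ some i, w b ⟩`. -/
abbrev SwapGroup (w : B → FreeGroup (Option ι)) : Type _ := PresentedGroup (swapRels w)

/-- The generator `some i` is a relator. -/
theorem of_some_mem_swapRels (w : B → FreeGroup (Option ι)) (i : ι) :
    FreeGroup.of (some i) ∈ swapRels w := Or.inl ⟨i, rfl⟩

/-- The word `w b` is a relator. -/
theorem word_mem_swapRels (w : B → FreeGroup (Option ι)) (b : B) : w b ∈ swapRels w :=
  Or.inr ⟨b, rfl⟩

/-- In the swap group every dotted-circle generator is trivial. -/
theorem of_some_eq_one (w : B → FreeGroup (Option ι)) (i : ι) :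
    (PresentedGroup.of (some i) : SwapGroup w) = 1 :=
  PresentedGroup.one_of_mem (of_some_mem_swapRels w i)

/-- The exponent-sum homomorphism descends to the swap group when every word `w b` has exponent
sum `0` in the meridian. -/
def toZ (w : B → FreeGroup (Option ι)) (hw : ∀ b, expSumC (w b) = 1) :
    SwapGroup w →* Multiplicative ℤ :=
  PresentedGroup.toGroup (f := genZ) (by
    intro r hr
    rcases hr with ⟨i, rfl⟩ | ⟨b, rfl⟩
    · simp [genZ]
    · exact hw b)

/-- `toZ` on generators. -/
@[simp] theorem toZ_of (w : B → FreeGroup (Option ι)) (hw : ∀ b, expSumC (w b) = 1) (a : Option ι) :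
    toZ w hw (PresentedGroup.of a) = genZ a := by
  simp [toZ]

/-- The meridian class generates: `n ↦ c ^ n`. -/
def fromZ (w : B → FreeGroup (Option ι)) : Multiplicative ℤ →* SwapGroup w :=
  zpowersHom (SwapGroup w) (PresentedGroup.of none)

/-- `fromZ n = c ^ n`. -/
@[simp] theorem fromZ_apply (w : B → FreeGroup (Option ι)) (n : Multiplicative ℤ) :
    fromZ w n = (PresentedGroup.of none : SwapGroup w) ^ n.toAdd := by
  simp [fromZ]

/-- `toZ ∘ fromZ = id`. -/
theorem toZ_comp_fromZ (w : B → FreeGroup (Option ι)) (hw : ∀ b, expSumC (w b) = 1) :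
    (toZ w hw).comp (fromZ w) = MonoidHom.id _ := by
  ext
  simp [genZ]

/-- `fromZ ∘ toZ = id`: the meridian class generates the swap group. -/
theorem fromZ_comp_toZ (w : B → FreeGroup (Option ι)) (hw : ∀ b, expSumC (w b) = 1) :
    (fromZ w).comp (toZ w hw) = MonoidHom.id _ := by
  ext a
  cases a with
  | none => simp [genZ]
  | some i => simp [of_some_eq_one w i]

/-- MAIN STATEMENT.  The swap group is infinite cyclic, generated by the meridian:
`⟨ Option ι ∣ some i (i : ι), w b (b : B) ⟩ ≃* ℤ` whenever every `w b` has meridian exponent sum `0`. -/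
def swapGroupEquivInt (w : B → FreeGroup (Option ι)) (hw : ∀ b, expSumC (w b) = 1) :
    SwapGroup w ≃* Multiplicative ℤ :=
  MonoidHom.toMulEquiv (toZ w hw) (fromZ w) (fromZ_comp_toZ w hw) (toZ_comp_fromZ w hw)

/-- The isomorphism sends the meridian to `1`. -/
@[simp] theorem swapGroupEquivInt_of_none (w : B → FreeGroup (Option ι)) (hw : ∀ b, expSumC (w b) = 1) :
    swapGroupEquivInt w hw (PresentedGroup.of none) = ofAdd 1 := by
  simp [swapGroupEquivInt, genZ]

/-- Propositional form: the swap group is isomorphic to `ℤ`. -/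
theorem nonempty_swapGroup_mulEquiv_int (w : B → FreeGroup (Option ι))
    (hw : ∀ b, expSumC (w b) = 1) : Nonempty (SwapGroup w ≃* Multiplicative ℤ) :=
  ⟨swapGroupEquivInt w hw⟩

/-- In particular the swap group is commutative (so every finite non-abelian quotient test, e.g. the
`A₅`/`S₇` certificates used elsewhere in this residency, is void for swap spheres). -/
theorem swapGroup_comm (w : B → FreeGroup (Option ι)) (hw : ∀ b, expSumC (w b) = 1)
    (x y : SwapGroup w) : x * y = y * x := by
  apply (swapGroupEquivInt w hw).injective
  rw [map_mul, map_mul, mul_comm]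

end SwapSphere
end Summit.SmoothPoincare4.SmoothPoincare4.Theorems
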